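import Mathlib
import Summits.Ventures.PercRepro.TriangleCapRowA2CapRef

/-!
# PercRepro — THE CAP ON `(k, a, a + 2)` ON THE ROWS `a ∈ {5, 6}`: THE ARITHMETIC (p3, gen 47; part 200zm)

On the rows `a ∈ {5, 6}` the count `(a − 2) M ≤ a + 2` allows a matching of size `2` in `N(x)`, and the structure
is rigid: `P = |R| (K − 2) − (6 − a)` with every `u ∈ R` at `≤ K − 2`. At `a = 6` every `u ∈ R` is at exactly
`K − 2` (`rowA2_M2_arith_six`, slack `2K − 16` against the triple-broom gap `2k + 2a − 14 = 2k − 2`); at `a = 5` one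
vertex of `R` is at `K − 3` (`rowA2_R_sum_one`: `Σ_R d² + 2 (K − 2) ≤ 4 (K − 2)² + 1`) and the target is the
one-triangle gap `2k − 6` (`rowA2_M2_arith_five`, slack `2K − 13`); at `M = 1`, `a = 5`, the joint accounting closes
with slack `0` against `2k − 6` (`rowA2_sq_arith_five`). Axioms: standard.
-/

namespace PercRepro

namespace TriangleCap

namespace C047

open Finset

/-- **THE ARITHMETIC OF `M = 1` AT `r = a + 2`, `a = 5`:** against the one-triangle gap `2k − 6`; slack `0`. -/
theorem rowA2_sq_arith_five (a' K P SN SR np m : ℕ) (ha' : a' = 0) (hn : np ≤ 4) (hK : 2 * (a' + 5) + 2 ≤ K)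
    (hm : m + (a' + 5 + 2) = (a' + 5) * K) (hP : P + (a' + 5 + 3) + K = (a' + 5) * K)
    (hSN : SN + 4 * (a' + 5 - 1 - np) ≤ K + 6 + (a' + 5 + 1) * P + 2 * (a' + 5 - 1))
    (hSR : SR + 8 * (K - 1) + 4 * np ≤ (a' + 5 - 1) * ((K - 1) * (K - 1)) + 20) :
    K * K + SN + SR + (a' + 5 + 2) * (K + (a' + 5) - 1 - (a' + 5 + 2)) + (2 * (K + (a' + 5)) - 6) ≤
      m * (K + (a' + 5)) := by
  subst ha'
  obtain ⟨t, rfl⟩ : ∃ t, K = t + 12 := ⟨K - 12, by omega⟩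
  have e1 : t + 12 + (0 + 5) - 1 - (0 + 5 + 2) = t + 9 := by omega
  have e2 : 2 * (t + 12 + (0 + 5)) - 6 = 2 * t + 28 := by omega
  have e4 : 0 + 5 - 1 = 4 := by omega
  have e5 : t + 12 - 1 = t + 11 := by omega
  rw [e1, e2]
  rw [e4, e5] at hSR
  have hSN' : SN + 4 * 4 ≤ t + 12 + 6 + (0 + 5 + 1) * P + 2 * 4 + 4 * np := by
    have e3 : 4 * (0 + 5 - 1 - np) + 4 * np = 4 * 4 := by omega
    omega
  have hm' : m = 5 * t + 53 := by omega
  have hP' : P = 4 * t + 40 := by omega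
  subst hm' hP'
  nlinarith [hSN', hSR]

/-- `d + δ = c` ⇒ `d² + 2cδ = c² + δ²`. -/
theorem delta_sq_gen (d δ c : ℕ) (h : d + δ = c) : d * d + 2 * c * δ = c * c + δ * δ := by
  subst h
  ring

/-- **THE `R`-SUM WITH ONE UNIT OF SLACK:** every `u ∈ R` at `≤ K − 2`, `Σ_R degIn N + 1 = |R| (K − 2)` ⇒
`Σ_R (degIn N)² + 2 (K − 2) ≤ |R| (K − 2)² + 1`. -/
theorem rowA2_R_sum_one {V : Type*} [DecidableEq V] (D : SimpleGraph V) [DecidableRel D.Adj] (R N : Finset V)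
    (K : ℕ) (hPle : ∀ u ∈ R, degIn D N u + 2 ≤ K) (hsum : ∑ u ∈ R, degIn D N u + 1 = R.card * (K - 2)) :
    ∑ u ∈ R, degIn D N u * degIn D N u + 2 * (K - 2) ≤ R.card * ((K - 2) * (K - 2)) + 1 := by
  have hδ : ∀ u ∈ R, degIn D N u + (K - 2 - degIn D N u) = K - 2 := fun u hu => by
    have := hPle u hu
    omega
  have hsumδ : ∑ u ∈ R, (K - 2 - degIn D N u) = 1 := by
    have h : ∑ u ∈ R, (degIn D N u + (K - 2 - degIn D N u)) = ∑ _u ∈ R, (K - 2) := sum_congr rfl hδ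
    rw [sum_add_distrib, sum_const, smul_eq_mul] at h
    omega
  have hsq : ∀ u ∈ R, degIn D N u * degIn D N u + 2 * (K - 2) * (K - 2 - degIn D N u) =
      (K - 2) * (K - 2) + (K - 2 - degIn D N u) * (K - 2 - degIn D N u) := fun u hu =>
    delta_sq_gen _ _ _ (hδ u hu)
  have hS1 : ∑ u ∈ R, degIn D N u * degIn D N u + 2 * (K - 2) * 1 =
      R.card * ((K - 2) * (K - 2)) + ∑ u ∈ R, (K - 2 - degIn D N u) * (K - 2 - degIn D N u) := by
    have h := sum_congr rfl hsq
    rw [sum_add_distrib, sum_add_distrib, sum_const, smul_eq_mul, ← mul_sum, hsumδ] at h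
    exact h
  have hS2 : ∑ u ∈ R, (K - 2 - degIn D N u) * (K - 2 - degIn D N u) ≤ 1 := by
    have hle : ∀ u ∈ R, (K - 2 - degIn D N u) * (K - 2 - degIn D N u) ≤ (K - 2 - degIn D N u) := by
      intro u hu
      have h1 : K - 2 - degIn D N u ≤ 1 := by
        rw [← hsumδ]
        exact single_le_sum (f := fun w => K - 2 - degIn D N w) (fun _ _ => Nat.zero_le _) hu
      have h2 := Nat.mul_le_mul_left (K - 2 - degIn D N u) h1
      rw [mul_one] at h2
      exact h2
    have h := sum_le_sum hle
    rw [hsumδ] at h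
    exact h
  omega

/-- **THE ARITHMETIC OF `M = 2` AT `r = a + 2`, `a = 6`:** `P = 5K − 10`, every `u ∈ R` at `K − 2`,
`S_N ≤ K + 12 + 7P + 2F`, `2F ≤ 20` ⇒ the triple-broom target; slack `2K − 16`. -/
theorem rowA2_M2_arith_six (a' K P SN SR F m : ℕ) (ha' : a' = 1) (hK : 2 * (a' + 5) + 2 ≤ K)
    (hm : m + (a' + 5 + 2) = (a' + 5) * K) (hP : P = 5 * K - 10)
    (hSN : SN ≤ K + 3 * (2 * 2) + (a' + 5 + 1) * P + 2 * F) (hF : 2 * F ≤ 20)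
    (hSR : SR = 5 * ((K - 2) * (K - 2))) :
    K * K + SN + SR + (a' + 5 + 2) * (K + (a' + 5) - 1 - (a' + 5 + 2)) +
        (2 * (K + (a' + 5)) + 2 * (a' + 5) - 14) ≤ m * (K + (a' + 5)) := by
  subst ha' hP hSR
  obtain ⟨t, rfl⟩ : ∃ t, K = t + 14 := ⟨K - 14, by omega⟩
  have e1 : t + 14 + (1 + 5) - 1 - (1 + 5 + 2) = t + 11 := by omega
  have e2 : 2 * (t + 14 + (1 + 5)) + 2 * (1 + 5) - 14 = 2 * t + 38 := by omega
  have e3 : t + 14 - 2 = t + 12 := by omega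
  have e4 : 5 * (t + 14) - 10 = 5 * t + 60 := by omega
  rw [e1, e2, e3]
  rw [e4] at hSN
  have hm' : m = 6 * t + 76 := by omega
  subst hm'
  nlinarith [hSN, hF]

/-- **THE ARITHMETIC OF `M = 2` AT `r = a + 2`, `a = 5`:** `P = 4K − 9`, `S_R + 2 (K − 2) ≤ 4 (K − 2)² + 1`,
`S_N ≤ K + 12 + 6P + 2F`, `2F ≤ 16` ⇒ the one-triangle target `2k − 6`; slack `2K − 13`. -/
theorem rowA2_M2_arith_five (a' K P SN SR F m : ℕ) (ha' : a' = 0) (hK : 2 * (a' + 5) + 2 ≤ K)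
    (hm : m + (a' + 5 + 2) = (a' + 5) * K) (hP : P = 4 * K - 9)
    (hSN : SN ≤ K + 3 * (2 * 2) + (a' + 5 + 1) * P + 2 * F) (hF : 2 * F ≤ 16)
    (hSR : SR + 2 * (K - 2) ≤ 4 * ((K - 2) * (K - 2)) + 1) :
    K * K + SN + SR + (a' + 5 + 2) * (K + (a' + 5) - 1 - (a' + 5 + 2)) + (2 * (K + (a' + 5)) - 6) ≤
      m * (K + (a' + 5)) := by
  subst ha' hP
  obtain ⟨t, rfl⟩ : ∃ t, K = t + 12 := ⟨K - 12, by omega⟩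
  have e1 : t + 12 + (0 + 5) - 1 - (0 + 5 + 2) = t + 9 := by omega
  have e2 : 2 * (t + 12 + (0 + 5)) - 6 = 2 * t + 28 := by omega
  have e3 : t + 12 - 2 = t + 10 := by omega
  have e4 : 4 * (t + 12) - 9 = 4 * t + 39 := by omega
  rw [e1, e2]
  rw [e3] at hSR
  rw [e4] at hSN
  have hm' : m = 5 * t + 53 := by omega
  subst hm'
  nlinarith [hSN, hF, hSR]

end C047

end TriangleCap

end PercRepro
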